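import Mathlib
import HarnessLib
import Summits.ResolutionOfSingularities.ResolutionOfSingularities.Theorems.WildQuotientsWildQuotientResolutionKSCentreChartOrigin
import Summits.ResolutionOfSingularities.ResolutionOfSingularities.Theorems.WildQuotientsWildQuotientResolutionKSCentreChartFractions

/-!
# The equivariant monoidal transform along a stable normal hyperplane of a stable centre
# (Kollár–Szabó going down, (K2-centres), local form; crux `WildQuotients.WildQuotientResolution`, stub `stub_phaseZeroHighDim`)

Crux stmt-ResolutionOfSingularities-15640 (`WildQuotientResolution`), registered stub `stub_phaseZeroHighDim`;
programme PHASE0-KS-EIGENLINE, item (K2-centres) — the monoidal analogue of hand 8-g1's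
✓`EigenlineChart.exists_equivariant_quadraticTransform` (the case `J = 𝔪`). Data: a local subring `S ⊆ K`, a
QUASI-REGULAR family `y` of non-units (the coordinates of a regular centre `J = (y)`, adapted by
✓`CentreEigenline.exists_generators_adapted_to_hyperplane`: `y_i = t ∉ W`, `y_j ∈ W`), an ideal
`W ≤ (y_j : j ≠ i) + 𝔪J` (the stable hyperplane of ✓`CentreEigenline.exists_stable_hyperplane`), and a family of
automorphisms `σ_h` of `K` preserving `S`, RESIDUE-TRIVIAL on `S`, with `σ_h y_j ∈ W` (`j ≠ i`) and
`σ_h y_i ≡ u_h y_i (mod W)`, `u_h` a unit (✓`CentreEigenline.exists_unit_mul_sub_mem_of_not_mem`). Then: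

* `sigma_mem_ofPrime_of_mem_closure` — for the chart origin `𝔫` (✓`CentreChart.exists_centreChartOrigin`) every
  `z ∈ S[J/y_i]` has `σ z ∈ S[J/y_i]_𝔫` and `σ z − z = b/s` with `b ∈ 𝔫`, `s ∉ 𝔫` (key identity
  `σ y_i = y_i · (u + w₀/y_i)`, `u + w₀/y_i ∉ 𝔫`; closure induction over `S ∪ {y_j/y_i}`);
* ★ `exists_equivariant_monoidalTransform` — the MONOIDAL TRANSFORM `R₁ = S[J/y_i]_𝔫` of `S` with centre `J` at the
  fixed point `[W]`: a local subring `R₁ ⊇ S` of `K` dominating `S` (`s ∈ 𝔪_S ↔ s` is a non-unit of `R₁`), with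
  `J R₁ = y_i R₁` (`c/y_i ∈ R₁` for `c ∈ J`; `y_i` and the `y_j/y_i` non-units), `σ_h`-STABLE for every `h`,
  with RESIDUE-TRIVIAL induced action (`σ_h z − z` a non-unit) and the SAME RESIDUE FIELD as `S` (every `z ∈ R₁`
  is congruent to some `s ∈ S`), and REGULAR as soon as the chart ring is (`IsRegularRing S[J/y_i]`, e.g.
  ✓`isRegularRing_closure_monoidalChart` for `S` regular and `y` part of a regular system of parameters).

So, with ✓`KSCentreEigenline` / ✓`KSCentreAdaptedGenerators` upstream and the scheme side
✓`KSGoingDown.exists_fixedPoint_liftAction_of_localChart_of_stalkIdeal` (p829964) downstream, what remains of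
(K2-centres) is the ring-level glue `_of_action` (hand 8-g2's ✓`KSBlowupEquivariantChart` pattern: transport an
abstract action on a regular local domain `A` to `S = im A ⊆ Frac A`) and the dimension count.

[OURS · crux stmt-ResolutionOfSingularities-15640 · helper toward `stub_phaseZeroHighDim` ((K2-centres), local form;
NOT a proof of the stub, NOT the scheme-level statement); folklore local algebra after [ReichsteinYoussin2000, App.,
Prop. A.2], counted 0; AI-level work, weaker than expert review.] [folklore]
-/

-- single-problem summit: the doubled namespace component `ResolutionOfSingularities` is forced
set_option linter.dupNamespace false

noncomputable section

namespace Summit.ResolutionOfSingularities.ResolutionOfSingularities.Theorems.WildQuotientResolution.CentreChart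

open IsLocalRing Literature.AlgebraicGeometry.Resolution
open Summit.ResolutionOfSingularities.ResolutionOfSingularities.Theorems.WildQuotientResolution
open Summit.ResolutionOfSingularities.ResolutionOfSingularities.Theorems.SwitchingDichotomy.ChartRsop
  (le_closure_chart div_mem_closure_chart)

universe u

variable {K : Type u} [Field K]

/-- **The chart ring moves into `S[J/y_i]_𝔫`, residue-trivially.** Let `S ⊆ K` be a local subring, `y` a family of
non-units with `y_i ≠ 0`, `J = (y)`, `𝔫` a prime of the chart ring `S[J/y_i]` over `𝔪_S` containing the `y_j/y_i`
(`j ≠ i`), and `W ≤ (y_j : j ≠ i) + 𝔪_S J`. Let `σ` be an automorphism of `K` preserving `S`, RESIDUE-TRIVIAL on `S`,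
with `σ y_j ∈ W` for `j ≠ i` and `σ y_i ≡ u·y_i (mod W)` for a unit `u`. Then for every `z ∈ S[J/y_i]`:
`σ z ∈ S[J/y_i]_𝔫` and `σ z - z = b/s` with `b ∈ 𝔫`, `s ∉ 𝔫`. Key computation: `σ y_i = y_i · c` with
`c = u + w₀/y_i ∈ S[J/y_i] ∖ 𝔫`, and `σ (y_j/y_i) = (σ y_j / y_i)/c` with `σ y_j / y_i ∈ 𝔫`. (Hand 8-g1's
✓`EigenlineChart.sigma_mem_ofPrime_of_mem_blowupRing` is the case `J = 𝔪`.) [folklore] -/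
theorem sigma_mem_ofPrime_of_mem_closure (S : Subring K) [IsLocalRing S] {r : ℕ} (y : Fin r → S)
    (i : Fin r) (hyi : y i ≠ 0)
    (𝔫 : Ideal (Subring.closure ((S : Set K) ∪ Set.range fun j => ((y j : S) : K) / ((y i : S) : K))))
    [h𝔫 : 𝔫.IsPrime]
    (hnj : ∀ j : Fin r, j ≠ i →
      ∀ hB : ((y j : S) : K) / ((y i : S) : K) ∈
        Subring.closure ((S : Set K) ∪ Set.range fun j => ((y j : S) : K) / ((y i : S) : K)),
      (⟨_, hB⟩ : Subring.closure ((S : Set K) ∪ Set.range fun j => ((y j : S) : K) / ((y i : S) : K))) ∈ 𝔫)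
    (hover : ∀ s : S, (⟨(s : K), le_closure_chart S y i s.2⟩ :
      Subring.closure ((S : Set K) ∪ Set.range fun j => ((y j : S) : K) / ((y i : S) : K))) ∈ 𝔫 ↔
      s ∈ maximalIdeal S)
    {W : Ideal S} (hWle : W ≤ Ideal.span (y '' {j | j ≠ i}) ⊔ maximalIdeal S * Ideal.span (Set.range y))
    (σ : K ≃+* K) (hσS : ∀ s ∈ S, σ s ∈ S)
    (hres : ∀ s : S, (⟨σ s, hσS s s.2⟩ : S) - s ∈ maximalIdeal S)
    (hWσ : ∀ j : Fin r, j ≠ i → (⟨σ ((y j : S) : K), hσS _ (y j).2⟩ : S) ∈ W)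
    (ht : ∃ u : S, IsUnit u ∧ (⟨σ ((y i : S) : K), hσS _ (y i).2⟩ : S) - u * y i ∈ W)
    {z : K} (hz : z ∈ Subring.closure ((S : Set K) ∪ Set.range fun j => ((y j : S) : K) / ((y i : S) : K))) :
    σ z ∈ (LocalSubring.ofPrime
        (Subring.closure ((S : Set K) ∪ Set.range fun j => ((y j : S) : K) / ((y i : S) : K))) 𝔫).toSubring ∧
      ∃ b s : Subring.closure ((S : Set K) ∪ Set.range fun j => ((y j : S) : K) / ((y i : S) : K)),
        b ∈ 𝔫 ∧ s ∉ 𝔫 ∧ σ z - z = b / s := by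
  -- adapted from hand 8-g1's `EigenlineChart.sigma_mem_ofPrime_of_mem_blowupRing` (`S[𝔪/t] ↦ S[J/y_i]`)
  classical
  let C : Subring K := Subring.closure ((S : Set K) ∪ Set.range fun j => ((y j : S) : K) / ((y i : S) : K))
  have hWJ : W ≤ Ideal.span (Set.range y) := le_span_of_le_hyperplane S y i hWle
  have ht0 : ((y i : S) : K) ≠ 0 := fun h => hyi (Subtype.ext h)
  have hCR₁ : C ≤ (LocalSubring.ofPrime C 𝔫).toSubring := LocalSubring.le_ofPrime _ 𝔫
  have hSC : S ≤ C := le_closure_chart S y i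
  have h1n : (1 : C) ∉ 𝔫 := fun h1 => h𝔫.ne_top ((Ideal.eq_top_iff_one _).mpr h1)
  have hJC : ∀ c : S, c ∈ Ideal.span (Set.range y) → (c : K) / ((y i : S) : K) ∈ C := fun c hc =>
    div_mem_closure_chart_of_mem_span S y i hc
  -- fractions `b/s`, `b ∈ 𝔫`, `s ∉ 𝔫`: members of `𝔫` qualify
  have hfrac_of_mem : ∀ {v : K} (hvB : v ∈ C), (⟨v, hvB⟩ : C) ∈ 𝔫 →
      ∃ b s : C, b ∈ 𝔫 ∧ s ∉ 𝔫 ∧ v = b / s :=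
    fun hvB hv => ⟨_, 1, hv, h1n, by simp⟩
  have hfrac_zero : ∃ b s : C, b ∈ 𝔫 ∧ s ∉ 𝔫 ∧ (0 : K) = b / s := ⟨0, 1, 𝔫.zero_mem, h1n, by simp⟩
  -- `σ y_i = y_i · c`, `c = u + w₀/y_i ∉ 𝔫`
  obtain ⟨u, hu, huW⟩ := ht
  set w₀ : S := (⟨σ ((y i : S) : K), hσS _ (y i).2⟩ : S) - u * y i with hw₀
  have hw₀B : (w₀ : K) / ((y i : S) : K) ∈ C := hJC w₀ (hWJ huW)
  have hw₀n : (⟨_, hw₀B⟩ : C) ∈ 𝔫 :=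
    div_mem_centreChartOrigin_of_mem S C hSC y i hJC 𝔫 hnj (fun s hs => (hover s).mpr hs) hWle huW hw₀B
  have hcB : (u : K) + (w₀ : K) / ((y i : S) : K) ∈ C := add_mem (hSC u.2) hw₀B
  have hc : (⟨_, hcB⟩ : C) ∉ 𝔫 := by
    intro hc
    have hu' : (⟨(u : K), hSC u.2⟩ : C) ∈ 𝔫 := by
      have e : (⟨(u : K), hSC u.2⟩ : C) = ⟨_, hcB⟩ - ⟨_, hw₀B⟩ := Subtype.ext (by simp)
      rw [e]; exact sub_mem hc hw₀n
    exact (IsLocalRing.mem_maximalIdeal _).mp ((hover u).mp hu') hu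
  have hσt : σ ((y i : S) : K) = ((y i : S) : K) * ((u : K) + (w₀ : K) / ((y i : S) : K)) := by
    have e : (w₀ : K) = σ ((y i : S) : K) - (u : K) * ((y i : S) : K) := by
      rw [hw₀, AddSubgroupClass.coe_sub, Subring.coe_mul]
    rw [e]
    field_simp
    ring
  -- closure induction over the ring generators `S ∪ {y_j/y_i}`
  induction hz using Subring.closure_induction with
  | mem z hz =>
    rcases hz with hzS | ⟨j, rfl⟩
    · -- `z ∈ S`: `σ z ∈ S`, `σ z - z ∈ 𝔪 ⊆ 𝔫`
      refine ⟨hCR₁ (hSC (hσS z hzS)), ?_⟩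
      have hm : (⟨σ z, hσS z hzS⟩ : S) - ⟨z, hzS⟩ ∈ maximalIdeal S := hres ⟨z, hzS⟩
      have hn := (hover _).mpr hm
      exact hfrac_of_mem (hSC ((⟨σ z, hσS z hzS⟩ : S) - ⟨z, hzS⟩).2) hn
    · dsimp only
      by_cases hj : j = i
      · rw [hj, div_self ht0, map_one, sub_self]
        exact ⟨Subring.one_mem _, hfrac_zero⟩
      · -- `σ (y_j/y_i) = (σ y_j / y_i) / c`
        have haB : σ ((y j : S) : K) / ((y i : S) : K) ∈ C := hJC _ (hWJ (hWσ j hj))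
        have han : (⟨_, haB⟩ : C) ∈ 𝔫 :=
          div_mem_centreChartOrigin_of_mem S C hSC y i hJC 𝔫 hnj (fun s hs => (hover s).mpr hs) hWle
            (hWσ j hj) haB
        have hσz : σ (((y j : S) : K) / ((y i : S) : K)) =
            (σ ((y j : S) : K) / ((y i : S) : K)) / ((u : K) + (w₀ : K) / ((y i : S) : K)) := by
          rw [map_div₀, hσt, div_div]
        have hfracσ : ∃ b s : C, b ∈ 𝔫 ∧ s ∉ 𝔫 ∧
            σ (((y j : S) : K) / ((y i : S) : K)) = b / s := ⟨_, _, han, hc, hσz⟩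
        refine ⟨mem_ofPrime_of_frac hfracσ, ?_⟩
        exact frac_sub hfracσ (hfrac_of_mem (div_mem_closure_chart S y i j) (hnj j hj _))
  | zero =>
    rw [map_zero, sub_self]
    exact ⟨Subring.zero_mem _, hfrac_zero⟩
  | one =>
    rw [map_one, sub_self]
    exact ⟨Subring.one_mem _, hfrac_zero⟩
  | add a b ha hb iha ihb =>
    refine ⟨by rw [map_add]; exact add_mem iha.1 ihb.1, ?_⟩
    rw [map_add, show σ a + σ b - (a + b) = (σ a - a) + (σ b - b) by ring]
    exact frac_add iha.2 ihb.2
  | neg a ha iha =>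
    refine ⟨by rw [map_neg]; exact neg_mem iha.1, ?_⟩
    rw [map_neg, show -σ a - -a = -(σ a - a) by ring]
    exact frac_neg iha.2
  | mul a b ha hb iha ihb =>
    refine ⟨by rw [map_mul]; exact mul_mem iha.1 ihb.1, ?_⟩
    rw [map_mul, show σ a * σ b - a * b = σ a * (σ b - b) + (σ a - a) * b by ring]
    exact frac_add (frac_mul_left iha.1 ihb.2) (frac_mul_right iha.2 (hCR₁ hb))

/-- **The equivariant monoidal transform along a stable normal hyperplane (Kollár–Szabó going down, (K2-centres),
local form).** Let `S ⊆ K` be a LOCAL subring, `y` a QUASI-REGULAR family of non-units with `y_i ≠ 0` and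
`J = (y)` (adapted coordinates of a regular stable centre: `t = y_i ∉ W`, `y_j ∈ W`), and
`W ≤ (y_j : j ≠ i) + 𝔪J` (the stable hyperplane of the fibre `J/𝔪J`). Let a family `σ_h` of automorphisms of `K`
preserve `S`, act RESIDUE-TRIVIALLY on `S`, map the `y_j` (`j ≠ i`) into `W` and satisfy `σ_h y_i ≡ u_h y_i (mod W)`
with `u_h` a unit. Then there is a local subring `R₁ ⊆ K` — the monoidal transform `S[J/y_i]_𝔫` at the origin
`[W]` of the chart `D₊(y_i)` of `Bl_J Spec S` (✓`exists_centreChartOrigin`) — which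
* contains `S` and DOMINATES it: `s ∈ 𝔪_S` iff `s` is a non-unit of `R₁` (zero or inverse outside);
* makes `J` principal, generated by `y_i`: `c/y_i ∈ R₁` for `c ∈ J`, with `y_i` and the `y_j/y_i` non-units;
* is `σ_h`-STABLE for every `h` — `[W]` is an `H`-fixed point of the blow-up along the centre;
* carries a RESIDUE-TRIVIAL action again (`σ_h z − z` a non-unit) and has the SAME RESIDUE FIELD as `S`;
* is a REGULAR local ring as soon as the chart ring `S[J/y_i]` is a regular ring (✓`isRegularRing_closure_monoidalChart`
  when `S` is regular and `y` is part of a regular system of parameters; ✓`KSGoingDown.isRegularLocalRing_ofPrime`).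
[cite: ReichsteinYoussin2000, Appendix, Prop. A.2] [cite: Liu2002, Thm. 8.1.19 (a)] -/
theorem exists_equivariant_monoidalTransform (S : Subring K) [IsLocalRing S] {r : ℕ} (y : Fin r → S)
    (hqr : IsQuasiRegular y) (hym : ∀ j, y j ∈ maximalIdeal S) (i : Fin r) (hyi : y i ≠ 0)
    {W : Ideal S} (hWle : W ≤ Ideal.span (y '' {j | j ≠ i}) ⊔ maximalIdeal S * Ideal.span (Set.range y))
    {H : Type*} (σ : H → K ≃+* K) (hσS : ∀ h : H, ∀ s ∈ S, σ h s ∈ S)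
    (hres : ∀ (h : H) (s : S), (⟨σ h s, hσS h s s.2⟩ : S) - s ∈ maximalIdeal S)
    (hWσ : ∀ (h : H) (j : Fin r), j ≠ i → (⟨σ h ((y j : S) : K), hσS h _ (y j).2⟩ : S) ∈ W)
    (ht : ∀ h : H, ∃ u : S, IsUnit u ∧ (⟨σ h ((y i : S) : K), hσS h _ (y i).2⟩ : S) - u * y i ∈ W) :
    ∃ R₁ : LocalSubring K,
      S ≤ R₁.toSubring ∧
      (∀ s : S, s ∈ maximalIdeal S ↔ ((s : K) = 0 ∨ ((s : K))⁻¹ ∉ R₁.toSubring)) ∧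
      (((y i : S) : K))⁻¹ ∉ R₁.toSubring ∧
      (∀ c : S, c ∈ Ideal.span (Set.range y) → (c : K) / ((y i : S) : K) ∈ R₁.toSubring) ∧
      (∀ j : Fin r, j ≠ i → ((y j : S) : K) / ((y i : S) : K) = 0 ∨
        (((y j : S) : K) / ((y i : S) : K))⁻¹ ∉ R₁.toSubring) ∧
      (∀ h : H, ∀ z ∈ R₁.toSubring, σ h z ∈ R₁.toSubring) ∧
      (∀ h : H, ∀ z ∈ R₁.toSubring, σ h z - z = 0 ∨ (σ h z - z)⁻¹ ∉ R₁.toSubring) ∧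
      (∀ z ∈ R₁.toSubring, ∃ s ∈ S, z - s = 0 ∨ (z - s)⁻¹ ∉ R₁.toSubring) ∧
      (IsRegularRing (Subring.closure ((S : Set K) ∪ Set.range fun j => ((y j : S) : K) / ((y i : S) : K))) →
        IsRegularLocalRing R₁.toSubring) := by
  classical
  let C : Subring K := Subring.closure ((S : Set K) ∪ Set.range fun j => ((y j : S) : K) / ((y i : S) : K))
  have ht0 : ((y i : S) : K) ≠ 0 := fun h => hyi (Subtype.ext h)
  have hSC : S ≤ C := le_closure_chart S y i
  have hJC : ∀ c : S, c ∈ Ideal.span (Set.range y) → (c : K) / ((y i : S) : K) ∈ C := fun c hc =>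
    div_mem_closure_chart_of_mem_span S y i hc
  obtain ⟨𝔫, hmax, hni, hnj, hover, hcong⟩ := exists_centreChartOrigin S y hqr hym i hyi
  haveI : 𝔫.IsPrime := hmax.isPrime
  have hCR₁ : C ≤ (LocalSubring.ofPrime C 𝔫).toSubring := LocalSubring.le_ofPrime _ 𝔫
  have hnj' : ∀ j : Fin r, j ≠ i → ∀ hB : ((y j : S) : K) / ((y i : S) : K) ∈ C, (⟨_, hB⟩ : C) ∈ 𝔫 :=
    fun j hj _ => hnj j hj
  -- the claim, for each `σ h`
  have claim : ∀ (h : H) {z : K}, z ∈ C →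
      σ h z ∈ (LocalSubring.ofPrime C 𝔫).toSubring ∧ ∃ b s : C, b ∈ 𝔫 ∧ s ∉ 𝔫 ∧ σ h z - z = b / s :=
    fun h z hz => sigma_mem_ofPrime_of_mem_closure S y i hyi 𝔫 hnj' hover hWle (σ h) (hσS h)
      (hres h) (hWσ h) (ht h) hz
  refine ⟨LocalSubring.ofPrime C 𝔫, hSC.trans hCR₁, fun s => ?_, ?_, fun c hc => hCR₁ (hJC c hc),
    fun j hj => ?_, fun h z hz => ?_, fun h z hz => ?_, fun z hz => ?_, fun hreg => ?_⟩
  · -- domination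
    constructor
    · intro hs
      exact eq_zero_or_inv_not_mem_of_frac (exists_frac_of_mem ((hover s).mpr hs))
    · rintro (h0 | hinv)
      · exact (mem_maximalIdeal_iff_inv_not_mem s).mpr (Or.inl h0)
      · exact (mem_maximalIdeal_iff_inv_not_mem s).mpr (Or.inr fun h => hinv (hCR₁ (hSC h)))
  · -- `y_i` is a non-unit
    rcases eq_zero_or_inv_not_mem_of_frac (exists_frac_of_mem hni) with h0 | h
    · exact absurd h0 ht0
    · exact h
  · exact eq_zero_or_inv_not_mem_of_frac (exists_frac_of_mem (hnj j hj))
  · -- stability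
    obtain ⟨a, s, hs, rfl⟩ := mem_ofPrime_iff.mp hz
    have hσs : σ h (s : K) = (s : K) + (σ h (s : K) - s) := by ring
    have hinv : (σ h (s : K))⁻¹ ∈ (LocalSubring.ofPrime C 𝔫).toSubring := by
      rw [hσs]
      exact inv_add_mem_ofPrime hs (claim h s.2).2
    rw [map_div₀, div_eq_mul_inv]
    exact mul_mem (claim h a.2).1 hinv
  · -- residue-triviality
    obtain ⟨a, s, hs, rfl⟩ := mem_ofPrime_iff.mp hz
    have hs0 : ((s : C) : K) ≠ 0 := coe_ne_zero_of_not_mem hs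
    have hσs0 : σ h (s : K) ≠ 0 := (map_ne_zero_iff _ (σ h).injective).mpr hs0
    have hσs : σ h (s : K) = (s : K) + (σ h (s : K) - s) := by ring
    have hinv : (σ h (s : K))⁻¹ ∈ (LocalSubring.ofPrime C 𝔫).toSubring := by
      rw [hσs]
      exact inv_add_mem_ofPrime hs (claim h s.2).2
    have e : σ h ((a : K) / s) - (a : K) / s =
        ((σ h (a : K) - a) * s - a * (σ h (s : K) - s)) * ((σ h (s : K))⁻¹ * (s : K)⁻¹) := by
      rw [map_div₀]
      field_simp
      ring
    rw [e]
    refine eq_zero_or_inv_not_mem_of_frac (frac_mul_right ?_ (mul_mem hinv (inv_mem_ofPrime hs)))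
    exact frac_sub (frac_mul_right (claim h a.2).2 (hCR₁ s.2)) (frac_mul_left (hCR₁ a.2) (claim h s.2).2)
  · -- same residue field
    obtain ⟨a, s, hs, rfl⟩ := mem_ofPrime_iff.mp hz
    have hs0 : ((s : C) : K) ≠ 0 := coe_ne_zero_of_not_mem hs
    obtain ⟨sa, hsa⟩ := hcong a
    obtain ⟨sb, hsb⟩ := hcong s
    have hsbm : sb ∉ maximalIdeal S := fun hm => by
      have h1 : s ∈ 𝔫 := by
        have e : s = (s - ⟨(sb : K), hSC sb.2⟩) + ⟨(sb : K), hSC sb.2⟩ := by ring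
        rw [e]; exact add_mem hsb ((hover sb).mpr hm)
      exact hs h1
    have hsb0 : (sb : K) ≠ 0 := by
      intro h0
      apply hsbm
      rw [show sb = 0 from Subtype.ext h0]
      exact (maximalIdeal S).zero_mem
    have hsbinv : (sb : K)⁻¹ ∈ S := by
      by_contra hni'
      exact hsbm ((mem_maximalIdeal_iff_inv_not_mem sb).mpr (Or.inr hni'))
    refine ⟨(sa : K) * (sb : K)⁻¹, mul_mem sa.2 hsbinv, ?_⟩
    have e : (a : K) / s - (sa : K) * (sb : K)⁻¹ =
        (((a : K) - sa) * sb - sa * ((s : K) - sb)) * ((s : K)⁻¹ * (sb : K)⁻¹) := by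
      field_simp
      ring
    rw [e]
    refine eq_zero_or_inv_not_mem_of_frac (frac_mul_right ?_ (mul_mem (inv_mem_ofPrime hs) (hCR₁ (hSC hsbinv))))
    refine frac_sub (frac_mul_right (exists_frac_of_mem hsa) (hCR₁ (hSC sb.2)))
      (frac_mul_left (hCR₁ (hSC sa.2)) (exists_frac_of_mem hsb))
  · -- regularity
    haveI := hreg
    exact KSGoingDown.isRegularLocalRing_ofPrime C 𝔫

end Summit.ResolutionOfSingularities.ResolutionOfSingularities.Theorems.WildQuotientResolution.CentreChart

end
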